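import Summits.Ventures.PercRepro.ProfilePointedMoves

/-!
# PercRepro — THE BOUNDS ON THE BLOCKED MOVES: THE `p`-GIRTH REGIME OF (C1′) AND THE LEVEL INEQUALITY
`(ρ − k)·κ_k ≤ (k + 2 − g)·κ_{k+1}`   (p10, gen 16; `proofs/P10-AVFULL.md` §24(d)–(f))

For a finite matroid `M` on `N = #E` of rank `ρ`, a point `p` and the captured family `𝒦 = capSets M p` with its
levels `κ_k = capCount M k p`, ProfilePointedMoves gives `Σ_{X ∈ 𝒦} (2 #X − N) = Σ_{X ∈ 𝒦} (#downBlocked − 1 − #upBlocked)`.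
THE TWO BOUNDS: (i) `#upBlocked X ≤ N − 1 − ρ` — the `p`-side minus `p` contains at least `ρ − #X` elements outside
`cl X`, since `X ∪ upMoves X` spans `E` (`rk_gr_le_card_add_card_upMoves`, `card_upBlocked_add_rk_le`);
(ii) `#downBlocked X ≥ #fundCirc X` — the fundamental circuit of `p` minus `p` consists of blocked down-moves; and
`p ∈ cl(fundCirc X)` (`mem_clF_fundCirc`, Mathlib's `fundCircuit`), so `fundCirc X` is nonempty for a non-loop `p`
and has `≥ g − 1` elements whenever every circuit through `p` has `≥ g` elements (`fundCirc_bound_of_pGirth`).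
CONSEQUENCES (all unconditional theorems): `Σ_{X ∈ 𝒦} (2 #X − N) ≥ (g − 1 − (N − ρ)) · #𝒦`
(`sum_capSets_signed_ge_of_fundCirc`); THE `p`-GIRTH REGIME OF (C1′): (C1′) holds at `(M, p)` whenever every circuit
through `p` has at least `N − ρ + 1` elements (`capLimit_body_of_fundCirc`, `capLimit_body_of_pGirth`); and THE LEVEL
INEQUALITY `(ρ − k)·κ_k ≤ (k + 2 − g)·κ_{k+1}` (`level_ineq_of_fundCirc`), in particular `(ρ − k)·κ_k ≤ k·κ_{k+1}` for
every non-loop `p` and every `k` (`level_ineq`) — Theorem A's shape with `ρ` in place of the `N − 1` of (A1κ).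
Nothing here asserts (C1′), (★), (A1κ) or (CM) beyond these regimes.
-/

open scoped Matroid

namespace PercRepro.Cogirth

open Finset ThmH Skew

variable {α : Type} [DecidableEq α] {M : Matroid α} [M.Finite]

/-! ### Rank and closure on finsets -/

omit [DecidableEq α] in
/-- `rk` is monotone. -/
theorem rk_le_rk_of_subset_finset {S T : Finset α} (h : S ⊆ T) : rk M S ≤ rk M T := by
  have := M.eRk_mono (show (S : Set α) ⊆ (T : Set α) by exact_mod_cast h)
  rw [← coe_rk, ← coe_rk] at this
  exact_mod_cast this

omit [DecidableEq α] in
/-- The rank of the closure. -/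
theorem rk_clF_eq_rk (S : Finset α) : rk M (clF M S) = rk M S := by
  unfold rk
  rw [coe_clF, M.eRk_closure_eq]

omit [DecidableEq α] in
/-- A subset of the ground set lies in its closure. -/
theorem subset_clF_self_of_subset_gr {S : Finset α} (hS : S ⊆ gr M) : S ⊆ clF M S := by
  intro x hx
  rw [mem_clF_iff]
  have hSE : (S : Set α) ⊆ M.E := by
    rw [← coe_gr]
    exact_mod_cast hS
  exact M.subset_closure (S : Set α) hSE (mem_coe.2 hx)

/-! ### Bound (i): the blocked up-moves -/

/-- `X ∪ upMoves X` spans the ground set: `ρ ≤ #X + #upMoves X` for a captured `X`. -/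
theorem rk_gr_le_card_add_card_upMoves {p : α} {X : Finset α} (hX : X ∈ capSets M p) :
    rk M (gr M) ≤ X.card + (upMoves M p X).card := by
  obtain ⟨⟨hXb, -⟩, hpcl⟩ := mem_capSets.1 hX
  have hXg : X ⊆ gr M := (mem_biIndepAll.1 hXb).1
  have hU : X ∪ upMoves M p X ⊆ gr M := union_subset hXg (upMoves_subset_gr p X)
  have hsub : gr M ⊆ clF M (X ∪ upMoves M p X) := by
    intro z hz
    by_cases hzX : z ∈ X
    · exact subset_clF_self_of_subset_gr hU (mem_union_left _ hzX)
    by_cases hzp : z = p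
    · subst hzp
      exact mem_clF_of_subset subset_union_left hpcl
    by_cases hzcl : z ∈ clF M X
    · exact mem_clF_of_subset subset_union_left hzcl
    · have hzu : z ∈ upMoves M p X := by
        unfold upMoves
        rw [mem_filter, mem_erase, mem_sdiff]
        exact ⟨⟨hzp, hz, hzX⟩, hzcl⟩
      exact subset_clF_self_of_subset_gr hU (mem_union_right _ hzu)
  calc rk M (gr M) ≤ rk M (clF M (X ∪ upMoves M p X)) := rk_le_rk_of_subset_finset hsub
    _ = rk M (X ∪ upMoves M p X) := rk_clF_eq_rk _
    _ ≤ (X ∪ upMoves M p X).card := rk_le_card _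
    _ ≤ X.card + (upMoves M p X).card := card_union_le _ _

/-- **BOUND (i)**: `#upBlocked X ≤ N − 1 − ρ`, as `#upBlocked X + ρ + 1 ≤ N`. -/
theorem card_upBlocked_add_rk_le {p : α} (hp : p ∈ gr M) {X : Finset α} (hX : X ∈ capSets M p) :
    (upBlocked M p X).card + rk M (gr M) + 1 ≤ (gr M).card := by
  have h1 := card_upMoves_add_card_upBlocked (M := M) p X
  have h2 := card_pSide_add hp hX
  have h3 := rk_gr_le_card_add_card_upMoves hX
  omega

/-! ### Bound (ii): the blocked down-moves and the fundamental circuit -/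

/-- **BOUND (ii)**: `#fundCirc X ≤ #downBlocked X`. -/
theorem card_fundCirc_le_card_downBlocked (p : α) (X : Finset α) :
    (fundCirc M p X).card ≤ (downBlocked M p X).card :=
  card_le_card (fundCirc_subset_downBlocked p X)

/-- `p` is spanned by its fundamental circuit minus `p`: `p ∈ cl(fundCirc X)` for a captured `X` (Mathlib's
`fundCircuit p X` is a circuit inside `X ∪ p` whose elements `x ≠ p` are exactly those with `p ∉ cl(X ∖ x)`). -/
theorem mem_clF_fundCirc {p : α} {X : Finset α} (hX : X ∈ capSets M p) : p ∈ clF M (fundCirc M p X) := by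
  obtain ⟨⟨hXb, hpX⟩, hpcl⟩ := mem_capSets.1 hX
  have hI : M.Indep (X : Set α) := indep_of_mem_biIndepAll hXb
  have hecl : p ∈ M.closure (X : Set α) := mem_clF_iff.1 hpcl
  have heI : p ∉ (X : Set α) := by exact_mod_cast hpX
  have hC := hI.fundCircuit_isCircuit hecl heI
  have hpC : p ∈ M.closure (M.fundCircuit p (X : Set α) \ {p}) :=
    hC.mem_closure_sdiff_singleton_of_mem (M.mem_fundCircuit p (X : Set α))
  have hsub : M.fundCircuit p (X : Set α) \ {p} ⊆ ((fundCirc M p X : Finset α) : Set α) := by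
    intro x hx
    obtain ⟨hxC, hxp⟩ := hx
    have hxp' : x ≠ p := fun h => hxp (Set.mem_singleton_iff.2 h)
    have hxI : x ∈ (X : Set α) := by
      rcases Set.mem_insert_iff.1 (M.fundCircuit_subset_insert p (X : Set α) hxC) with h | h
      · exact absurd h hxp'
      · exact h
    rw [hI.mem_fundCircuit_iff hecl heI, ← Set.insert_sdiff_singleton_comm hxp'.symm] at hxC
    have hI' : M.Indep ((X : Set α) \ {x}) := hI.sdiff _
    have hpn : p ∉ (X : Set α) \ {x} := fun h => heI h.1
    have hx' : p ∉ M.closure ((X : Set α) \ {x}) := ((hI'.insert_indep_iff_of_notMem hpn).1 hxC).2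
    rw [mem_coe]
    unfold fundCirc
    rw [mem_filter]
    refine ⟨by exact_mod_cast hxI, ?_⟩
    rw [mem_clF_iff, coe_erase]
    exact hx'
  rw [mem_clF_iff]
  exact M.closure_subset_closure hsub hpC

/-- The fundamental circuit of a captured set is nonempty unless `p` is a loop. -/
theorem one_le_card_fundCirc {p : α} (hp : p ∉ clF M (∅ : Finset α)) {X : Finset α} (hX : X ∈ capSets M p) :
    1 ≤ (fundCirc M p X).card := by
  rw [Nat.one_le_iff_ne_zero, Ne, card_eq_zero]
  intro h
  have := mem_clF_fundCirc hX
  rw [h] at this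
  exact hp this

/-- From the `p`-girth hypothesis «every subset of `E ∖ p` spanning `p` has at least `g − 1` elements» (every circuit
through `p` has at least `g` elements) to the fundamental-circuit form. -/
theorem fundCirc_bound_of_pGirth {p : α} {g : ℕ}
    (hg : ∀ T ⊆ (gr M).erase p, p ∈ clF M T → g ≤ T.card + 1) :
    ∀ X ∈ capSets M p, g ≤ (fundCirc M p X).card + 1 := by
  intro X hX
  apply hg
  · have hXa : X ∈ avoidSets M p := by
      obtain ⟨⟨hXb, hpX⟩, -⟩ := mem_capSets.1 hX
      exact mem_avoidSets.2 ⟨hXb, hpX⟩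
    exact (filter_subset _ _).trans (subset_erase_of_mem_avoidSets hXa)
  · exact mem_clF_fundCirc hX

/-! ### The `p`-girth regime of (C1′) -/

/-- **THE `p`-GIRTH BOUND**: if every fundamental circuit of `p` through a captured set has at least `g` elements,
then `Σ_{X ∈ 𝒦} (2 #X − N) ≥ (g − 1 − (N − ρ)) · #𝒦`. -/
theorem sum_capSets_signed_ge_of_fundCirc {p : α} (hp : p ∈ gr M) {g : ℕ}
    (hg : ∀ X ∈ capSets M p, g ≤ (fundCirc M p X).card + 1) :
    ((g : ℤ) + rk M (gr M) - (gr M).card - 1) * (capSets M p).card ≤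
      ∑ X ∈ capSets M p, (2 * (X.card : ℤ) - (gr M).card) := by
  rw [sum_capSets_signed_eq_blocked hp]
  have hpt : ∀ X ∈ capSets M p, (g : ℤ) + rk M (gr M) - (gr M).card - 1 ≤
      ((downBlocked M p X).card : ℤ) - 1 - (upBlocked M p X).card := by
    intro X hX
    have h1 : ((upBlocked M p X).card : ℤ) + rk M (gr M) + 1 ≤ (gr M).card := by
      exact_mod_cast card_upBlocked_add_rk_le hp hX
    have h2 : ((fundCirc M p X).card : ℤ) ≤ (downBlocked M p X).card := by
      exact_mod_cast card_fundCirc_le_card_downBlocked (M := M) p X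
    have h3 : (g : ℤ) ≤ (fundCirc M p X).card + 1 := by exact_mod_cast hg X hX
    linarith
  calc ((g : ℤ) + rk M (gr M) - (gr M).card - 1) * (capSets M p).card
      = ∑ X ∈ capSets M p, ((g : ℤ) + rk M (gr M) - (gr M).card - 1) := by
        rw [sum_const, nsmul_eq_mul, mul_comm]
    _ ≤ _ := sum_le_sum hpt

/-- **THE `p`-GIRTH REGIME OF (C1′)**: if every fundamental circuit of `p` through a captured set has at least
`N − ρ + 1` elements, then (C1′) holds at `(M, p)`: `N · Σ_k κ_k ≤ 2 · Σ_k k · κ_k`. -/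
theorem capLimit_body_of_fundCirc {p : α} (hp : p ∈ gr M) {g : ℕ}
    (hg : ∀ X ∈ capSets M p, g ≤ (fundCirc M p X).card + 1) (hgN : (gr M).card + 1 ≤ g + rk M (gr M)) :
    (gr M).card * ∑ k ∈ range ((gr M).card + 1), capCount M k p ≤
      2 * ∑ k ∈ range ((gr M).card + 1), k * capCount M k p := by
  have h0 : (0 : ℤ) ≤ ∑ X ∈ capSets M p, (2 * (X.card : ℤ) - (gr M).card) := by
    have h := sum_capSets_signed_ge_of_fundCirc hp hg
    have hc : (0 : ℤ) ≤ (g : ℤ) + rk M (gr M) - (gr M).card - 1 := by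
      have : ((gr M).card : ℤ) + 1 ≤ g + rk M (gr M) := by exact_mod_cast hgN
      linarith
    exact le_trans (mul_nonneg hc (by exact_mod_cast Nat.zero_le _)) h
  rw [sum_capSets_eq_levels] at h0
  have hsplit : ∑ k ∈ range ((gr M).card + 1), ((2 * (k : ℤ) - (gr M).card) * (capCount M k p : ℤ)) =
      2 * ∑ k ∈ range ((gr M).card + 1), ((k : ℤ) * (capCount M k p : ℤ)) -
        ((gr M).card : ℤ) * ∑ k ∈ range ((gr M).card + 1), (capCount M k p : ℤ) := by
    rw [mul_sum, mul_sum, ← sum_sub_distrib]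
    apply sum_congr rfl
    intro k _
    ring
  rw [hsplit] at h0
  have : (((gr M).card * ∑ k ∈ range ((gr M).card + 1), capCount M k p : ℕ) : ℤ) ≤
      ((2 * ∑ k ∈ range ((gr M).card + 1), k * capCount M k p : ℕ) : ℤ) := by
    push_cast
    linarith
  exact_mod_cast this

/-- **THE `p`-GIRTH REGIME OF (C1′), CIRCUIT FORM**: if every circuit through `p` has at least `N − ρ + 1` elements
(every subset of `E ∖ p` spanning `p` has at least `N − ρ` elements), then (C1′) holds at `(M, p)`. -/
theorem capLimit_body_of_pGirth {p : α} (hp : p ∈ gr M) {g : ℕ}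
    (hg : ∀ T ⊆ (gr M).erase p, p ∈ clF M T → g ≤ T.card + 1) (hgN : (gr M).card + 1 ≤ g + rk M (gr M)) :
    (gr M).card * ∑ k ∈ range ((gr M).card + 1), capCount M k p ≤
      2 * ∑ k ∈ range ((gr M).card + 1), k * capCount M k p :=
  capLimit_body_of_fundCirc hp (fundCirc_bound_of_pGirth hg) hgN

/-! ### The level inequality -/

/-- **THE LEVEL INEQUALITY**: if every fundamental circuit of `p` through a captured set has at least `g` elements,
then `(ρ − k) · κ_k ≤ (k + 2 − g) · κ_{k+1}` for every `k` (the up-moves at level `k` number at least `ρ − k` per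
set, the down-moves at level `k + 1` at most `k + 2 − g` per set, and the two are equinumerous). -/
theorem level_ineq_of_fundCirc {p : α} (hp : p ∈ gr M) {g : ℕ}
    (hg : ∀ X ∈ capSets M p, g ≤ (fundCirc M p X).card + 1) (k : ℕ) :
    ((rk M (gr M) : ℤ) - k) * capCount M k p ≤ ((k : ℤ) + 2 - g) * capCount M (k + 1) p := by
  have hedge : ∑ X ∈ (capSets M p).filter (fun X => X.card = k), ((upMoves M p X).card : ℤ) =
      ∑ X ∈ (capSets M p).filter (fun X => X.card = k + 1), ((downMoves M p X).card : ℤ) := by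
    exact_mod_cast sum_card_upMoves_eq_sum_card_downMoves_level (M := M) p k
  have hlow : ((rk M (gr M) : ℤ) - k) * capCount M k p ≤
      ∑ X ∈ (capSets M p).filter (fun X => X.card = k), ((upMoves M p X).card : ℤ) := by
    rw [← card_capSets_filter]
    calc ((rk M (gr M) : ℤ) - k) * (((capSets M p).filter (fun X => X.card = k)).card : ℤ)
        = ∑ X ∈ (capSets M p).filter (fun X => X.card = k), ((rk M (gr M) : ℤ) - k) := by
          rw [sum_const, nsmul_eq_mul, mul_comm]
      _ ≤ _ := by
          apply sum_le_sum
          intro X hX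
          rw [mem_filter] at hX
          have h1 : ((upMoves M p X).card : ℤ) + (upBlocked M p X).card = ((gr M \ X).erase p).card := by
            exact_mod_cast card_upMoves_add_card_upBlocked (M := M) p X
          have h2 : (((gr M \ X).erase p).card : ℤ) + X.card + 1 = (gr M).card := by
            exact_mod_cast card_pSide_add hp hX.1
          have h3 : ((upBlocked M p X).card : ℤ) + rk M (gr M) + 1 ≤ (gr M).card := by
            exact_mod_cast card_upBlocked_add_rk_le hp hX.1
          have hk : (X.card : ℤ) = k := by exact_mod_cast hX.2
          linarith
  have hup : ∑ X ∈ (capSets M p).filter (fun X => X.card = k + 1), ((downMoves M p X).card : ℤ) ≤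
      ((k : ℤ) + 2 - g) * capCount M (k + 1) p := by
    rw [← card_capSets_filter]
    calc ∑ X ∈ (capSets M p).filter (fun X => X.card = k + 1), ((downMoves M p X).card : ℤ)
        ≤ ∑ X ∈ (capSets M p).filter (fun X => X.card = k + 1), ((k : ℤ) + 2 - g) := by
          apply sum_le_sum
          intro X hX
          rw [mem_filter] at hX
          have h1 : ((downMoves M p X).card : ℤ) + (downBlocked M p X).card = X.card := by
            exact_mod_cast card_downMoves_add_card_downBlocked (M := M) p X
          have h2 : ((fundCirc M p X).card : ℤ) ≤ (downBlocked M p X).card := by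
            exact_mod_cast card_fundCirc_le_card_downBlocked (M := M) p X
          have h3 : (g : ℤ) ≤ (fundCirc M p X).card + 1 := by exact_mod_cast hg X hX.1
          have hk : (X.card : ℤ) = k + 1 := by exact_mod_cast hX.2
          linarith
      _ = ((k : ℤ) + 2 - g) * (((capSets M p).filter (fun X => X.card = k + 1)).card : ℤ) := by
          rw [sum_const, nsmul_eq_mul, mul_comm]
  linarith

/-- **THE UNCONDITIONAL LEVEL INEQUALITY**: for every non-loop `p` and every `k`, `(ρ − k) · κ_k ≤ k · κ_{k+1}` —
the shape of (A1κ) with the rank `ρ` in place of `N − 1`. -/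
theorem level_ineq {p : α} (hp : p ∈ gr M) (hp0 : p ∉ clF M (∅ : Finset α)) (k : ℕ) :
    ((rk M (gr M) : ℤ) - k) * capCount M k p ≤ (k : ℤ) * capCount M (k + 1) p := by
  have h := level_ineq_of_fundCirc hp (g := 2) (fun X hX => by
    have := one_le_card_fundCirc hp0 hX
    omega) k
  have hk : ((k : ℤ) + 2 - (2 : ℕ)) = k := by push_cast; ring
  rw [hk] at h
  exact h

end PercRepro.Cogirth
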